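import Summits.QuantumFields.YangMills.Theorems.SwapVirialDeficitQuantitativeLaplaceChartRestrict
import Mathlib.MeasureTheory.Measure.Haar.InnerProductSpace
import Mathlib.MeasureTheory.Measure.Lebesgue.EqHaar
import HarnessLib

/-!
# Route `SwapVirialDeficit` (YangMills): the FIBREWISE DIAGONAL RESCALING CHART on `M × EuclideanSpace ℝ ι` —
# `(p, y) ↦ (p, (c_i(p)·y_i)_i)` pushes `(ν ⊗ vol)·Π_i|c_i(p)|` forward to `ν ⊗ vol`
# (generic half of «E1»: base-dependent fibre coordinates in the steep-window Morse–Bott bulk, free-hands support of ⟨stmt-QuantumFields-24197⟩)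

Width seat ym-line-sfw-p2-w2 g59 (cell ym-idea-1, free hands; `--supports stmt-QuantumFields-24197`; generic, model-free).  Why: in the gnomonic chart the leader
letters `x, y` live on affine lines `±(1, x₀, u)` and the natural fibre letters at the base point `x₀` are the NORMALISED ones `u/√(1+x₀²)` (fcl-p3 g47's
✓`taylor_four_gnoDeficit` bounds the Euler-ray jets in exactly these letters); rescaling the fibre coordinates by a base-dependent positive weight makes coercivity,
cubic datum, amplitude and far floor UNIFORM in `x₀`, so the bulk needs no gnomonic-end cut `|x₀| ≤ V₀`.  This file supplies the measure theory of such a chart: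

* §1 ★ `lintegral_comp_diagScale` — on `EuclideanSpace ℝ ι`, for `c : ι → ℝ` with every `c_i ≠ 0` and measurable `g ≥ 0`:
  `∫⁻ g = ofReal(Π_i|c_i|)·∫⁻ y, g((c_i y_i)_i)` (Mathlib ✓`map_linearMap_addHaar_pi_eq_smul_addHaar` on `ι → ℝ` with the diagonal matrix, ✓`det_diagonal`,
  transported by ✓`PiLp.volume_preserving_toLp`);
* §2 ★★ `lintegral_prod_comp_diagScale` — fibrewise, for measurable weights `p ↦ c_i(p) ≠ 0` on an s-finite base `(M, ν)`:
  `∫⁻ F d(ν ⊗ vol) = ∫⁻ F(p, (c_i(p)y_i)_i)·Π_i|c_i(p)| d(ν ⊗ vol)` (Tonelli twice); `measurable_diagScale`;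
* §3 ★★ `prod_volume_eq_map_diagScale` — the measure identity `ν ⊗ vol = Φ_*((ν ⊗ vol)·J)`, `Φ(p,y) = (p, (c_i(p)y_i)_i)`, `J = ofReal Π|c_i(p)|`
  (✓`eq_map_withDensity_of_forall_lintegral`); `diagScale_injective`, `image_diagScale_eq_preimage` ∕ `measurableSet_image_diagScale` (images of measurable sets are
  measurable: the inverse rescaling is measurable) — everything ✓`restrict_image_eq_map_of_eq_map` asks of a chart.

HONEST LABEL: elementary measure theory (theorems only, 0 `def`, 0 `sorry`, standard axioms); the rescaled MODEL sockets (uniform coercivity needs w3's blockwise ray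
floor; uniform far floor; cubic datum from ✓`taylor_four_gnoDeficit`) are NOT here.  ⟨24197⟩ ∕ ⟨24194⟩ OPEN; own crux ⟨22884⟩ OPEN (blocked-on ⟨19935⟩); the Yang–Mills mass
gap is NOT proved; no summit is proved by a line.  References: [cite: Breitung1994, §2.3 Definitions 4–5]; [folklore].
-/

set_option autoImplicit false

noncomputable section

open _root_.MeasureTheory _root_.MeasureTheory.Measure _root_.Set _root_.Module
open scoped _root_.ENNReal _root_.BigOperators

namespace Summit.QuantumFields.YangMills.Theorems.QuantitativeLaplace

variable {ι : Type*} [Fintype ι] [DecidableEq ι]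

/-! ## §1 One fibre: the diagonal linear change of variables on `EuclideanSpace ℝ ι` -/

/-- On `ι → ℝ`: `∫⁻ h((c_i w_i)_i) dw = ofReal|(Π c_i)⁻¹|·∫⁻ h` for measurable `h ≥ 0` and `c_i ≠ 0` (the diagonal matrix has determinant `Π c_i`). [folklore] -/
theorem lintegral_comp_diagScale_pi (c : ι → ℝ) (hc : ∀ i, c i ≠ 0) {h : (ι → ℝ) → ℝ≥0∞} (hh : Measurable h) :
    ∫⁻ w : ι → ℝ, h (fun i => c i * w i) = ENNReal.ofReal |(∏ i, c i)⁻¹| * ∫⁻ w : ι → ℝ, h w := by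
  have hdet : LinearMap.det (Matrix.toLin' (Matrix.diagonal c)) = ∏ i, c i := by
    rw [LinearMap.det_toLin', Matrix.det_diagonal]
  have hne : LinearMap.det (Matrix.toLin' (Matrix.diagonal c)) ≠ 0 := by
    rw [hdet]; exact Finset.prod_ne_zero_iff.2 fun i _ => hc i
  have hmap := map_linearMap_addHaar_pi_eq_smul_addHaar hne (volume : Measure (ι → ℝ))
  have hf : Measurable (Matrix.toLin' (Matrix.diagonal c) : (ι → ℝ) → (ι → ℝ)) :=
    (Matrix.toLin' (Matrix.diagonal c)).continuous_of_finiteDimensional.measurable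
  have e1 : (fun w : ι → ℝ => h (fun i => c i * w i)) = fun w => h (Matrix.toLin' (Matrix.diagonal c) w) := by
    funext w; congr 1; funext i; rw [Matrix.toLin'_apply, Matrix.mulVec_diagonal]
  rw [e1, ← lintegral_map hh hf, hmap, lintegral_smul_measure, hdet, smul_eq_mul]

/-- ★ **THE DIAGONAL CHANGE OF VARIABLES ON `EuclideanSpace ℝ ι`**: for `c_i ≠ 0` and measurable `g ≥ 0`,
`∫⁻ y, g y = ofReal(Π_i |c_i|) · ∫⁻ y, g((c_i y_i)_i)`. [folklore] -/
theorem lintegral_comp_diagScale (c : ι → ℝ) (hc : ∀ i, c i ≠ 0) {g : EuclideanSpace ℝ ι → ℝ≥0∞} (hg : Measurable g) :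
    ∫⁻ y : EuclideanSpace ℝ ι, g y = ENNReal.ofReal (∏ i, |c i|) * ∫⁻ y : EuclideanSpace ℝ ι, g (WithLp.toLp 2 fun i => c i * y i) := by
  -- transport both integrals to `ι → ℝ`
  have hT := PiLp.volume_preserving_toLp ι
  have hgT : Measurable fun w : ι → ℝ => g (WithLp.toLp 2 w) := hg.comp (WithLp.measurable_toLp 2 _)
  have h1 : ∫⁻ y : EuclideanSpace ℝ ι, g y = ∫⁻ w : ι → ℝ, g (WithLp.toLp 2 w) := (hT.lintegral_comp hg).symm
  have h2 : ∫⁻ y : EuclideanSpace ℝ ι, g (WithLp.toLp 2 fun i => c i * y i) = ∫⁻ w : ι → ℝ, g (WithLp.toLp 2 fun i => c i * w i) := by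
    have hm : Measurable fun y : EuclideanSpace ℝ ι => g (WithLp.toLp 2 fun i => c i * y i) :=
      hg.comp ((WithLp.measurable_toLp 2 _).comp (measurable_pi_lambda _ fun i =>
        measurable_const.mul ((measurable_pi_apply i).comp (WithLp.measurable_ofLp 2 (ι → ℝ)))))
    have h := hT.lintegral_comp hm
    exact h.symm
  rw [h1, h2, lintegral_comp_diagScale_pi c hc hgT, ← mul_assoc, ← ENNReal.ofReal_mul (Finset.prod_nonneg fun i _ => abs_nonneg _)]
  have hprod : (∏ i, |c i|) * |(∏ i, c i)⁻¹| = 1 := by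
    rw [← Finset.abs_prod, abs_inv, mul_inv_cancel₀]
    exact abs_ne_zero.2 (Finset.prod_ne_zero_iff.2 fun i _ => hc i)
  rw [hprod, ENNReal.ofReal_one, one_mul]

/-! ## §2 Fibrewise: Tonelli -/

section Fibrewise

variable {M : Type*} [MeasurableSpace M]

omit [Fintype ι] [DecidableEq ι] in
/-- The fibrewise rescaling map `(p, y) ↦ (p, (c_i(p) y_i)_i)` is measurable when every weight `p ↦ c_i(p)` is. [folklore] -/
theorem measurable_diagScale {c : M → ι → ℝ} (hc : ∀ i, Measurable fun p => c p i) :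
    Measurable fun q : M × EuclideanSpace ℝ ι => (q.1, (WithLp.toLp 2 fun i => c q.1 i * q.2 i : EuclideanSpace ℝ ι)) := by
  refine measurable_fst.prodMk ((WithLp.measurable_toLp 2 _).comp (measurable_pi_lambda _ fun i => ?_))
  exact ((hc i).comp measurable_fst).mul ((measurable_pi_apply i).comp ((WithLp.measurable_ofLp 2 (ι → ℝ)).comp measurable_snd))

omit [DecidableEq ι] in
/-- The Jacobian `p ↦ Π_i |c_i(p)|` is measurable. [folklore] -/
theorem measurable_diagScale_jacobian {c : M → ι → ℝ} (hc : ∀ i, Measurable fun p => c p i) :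
    Measurable fun q : M × EuclideanSpace ℝ ι => ENNReal.ofReal (∏ i, |c q.1 i|) :=
  ENNReal.measurable_ofReal.comp ((Finset.measurable_prod _ fun i _ => continuous_abs.measurable.comp (hc i)).comp measurable_fst)

/-- ★★ **FIBREWISE DIAGONAL CHANGE OF VARIABLES** (Tonelli twice + §1): for an s-finite base measure `ν`, measurable non-vanishing weights and measurable `F ≥ 0`,
`∫⁻ F d(ν ⊗ vol) = ∫⁻ F(p, (c_i(p)y_i)_i)·Π_i|c_i(p)| d(ν ⊗ vol)`. [folklore] -/
theorem lintegral_prod_comp_diagScale (ν : Measure M) [SFinite ν] {c : M → ι → ℝ} (hc : ∀ i, Measurable fun p => c p i) (hc0 : ∀ p i, c p i ≠ 0)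
    {F : M × EuclideanSpace ℝ ι → ℝ≥0∞} (hF : Measurable F) :
    ∫⁻ q, F q ∂(ν.prod volume) =
      ∫⁻ q : M × EuclideanSpace ℝ ι, F (q.1, (WithLp.toLp 2 fun i => c q.1 i * q.2 i : EuclideanSpace ℝ ι)) * ENNReal.ofReal (∏ i, |c q.1 i|) ∂(ν.prod volume) := by
  have hG : Measurable fun q : M × EuclideanSpace ℝ ι => F (q.1, (WithLp.toLp 2 fun i => c q.1 i * q.2 i : EuclideanSpace ℝ ι)) * ENNReal.ofReal (∏ i, |c q.1 i|) :=
    (hF.comp (measurable_diagScale hc)).mul (measurable_diagScale_jacobian hc)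
  rw [lintegral_prod _ hF.aemeasurable, lintegral_prod _ hG.aemeasurable]
  refine lintegral_congr fun p => ?_
  dsimp only
  have hFp : Measurable fun y : EuclideanSpace ℝ ι => F (p, y) := hF.comp (measurable_const.prodMk measurable_id)
  have hSm : Measurable fun y : EuclideanSpace ℝ ι => (WithLp.toLp 2 fun i => c p i * y i : EuclideanSpace ℝ ι) :=
    (WithLp.measurable_toLp 2 _).comp (measurable_pi_lambda _ fun i => measurable_const.mul ((measurable_pi_apply i).comp (WithLp.measurable_ofLp 2 (ι → ℝ))))
  have hFS : Measurable fun y : EuclideanSpace ℝ ι => F (p, (WithLp.toLp 2 fun i => c p i * y i : EuclideanSpace ℝ ι)) := by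
    have h := Measurable.comp hFp hSm
    exact h
  rw [lintegral_comp_diagScale (c p) (hc0 p) hFp, mul_comm, lintegral_mul_const _ hFS]

/-! ## §3 The chart identity and the set-theoretic bookkeeping -/

/-- ★★ **THE FIBREWISE RESCALING CHART IDENTITY**: `ν ⊗ vol = Φ_*((ν ⊗ vol)·J)` with `Φ(p, y) = (p, (c_i(p)y_i)_i)`, `J(p, y) = ofReal Π_i|c_i(p)|` — the `hμ` of
✓`restrict_image_eq_map_of_eq_map` for the rescaled fibre coordinates. [cite: Breitung1994, §2.3 Definitions 4–5] -/
theorem prod_volume_eq_map_diagScale (ν : Measure M) [SFinite ν] {c : M → ι → ℝ} (hc : ∀ i, Measurable fun p => c p i) (hc0 : ∀ p i, c p i ≠ 0) :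
    ν.prod (volume : Measure (EuclideanSpace ℝ ι)) =
      (((ν.prod volume).withDensity fun q : M × EuclideanSpace ℝ ι => ENNReal.ofReal (∏ i, |c q.1 i|)).map
        fun q : M × EuclideanSpace ℝ ι => (q.1, (WithLp.toLp 2 fun i => c q.1 i * q.2 i : EuclideanSpace ℝ ι))) :=
  eq_map_withDensity_of_forall_lintegral (measurable_diagScale hc) fun _ hF => lintegral_prod_comp_diagScale ν hc hc0 hF

omit [Fintype ι] [DecidableEq ι] [MeasurableSpace M] in
/-- The rescaling map is injective (non-vanishing weights). [folklore] -/
theorem diagScale_injective {c : M → ι → ℝ} (hc0 : ∀ p i, c p i ≠ 0) :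
    Function.Injective fun q : M × EuclideanSpace ℝ ι => (q.1, (WithLp.toLp 2 fun i => c q.1 i * q.2 i : EuclideanSpace ℝ ι)) := by
  rintro ⟨p, y⟩ ⟨p', y'⟩ h
  simp only [Prod.mk.injEq] at h
  obtain ⟨rfl, h2⟩ := h
  refine Prod.ext rfl (PiLp.ext fun i => ?_)
  have hi : c p i * y i = c p i * y' i := congrArg (fun v : EuclideanSpace ℝ ι => v i) h2
  exact mul_left_cancel₀ (hc0 p i) hi

omit [Fintype ι] [DecidableEq ι] [MeasurableSpace M] in
/-- The image of a set under the rescaling map is its preimage under the inverse rescaling `(p, y) ↦ (p, (y_i/c_i(p))_i)`. [folklore] -/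
theorem image_diagScale_eq_preimage {c : M → ι → ℝ} (hc0 : ∀ p i, c p i ≠ 0) (T : Set (M × EuclideanSpace ℝ ι)) :
    (fun q : M × EuclideanSpace ℝ ι => (q.1, (WithLp.toLp 2 fun i => c q.1 i * q.2 i : EuclideanSpace ℝ ι))) '' T =
      (fun q : M × EuclideanSpace ℝ ι => (q.1, (WithLp.toLp 2 fun i => (c q.1 i)⁻¹ * q.2 i : EuclideanSpace ℝ ι))) ⁻¹' T := by
  ext ⟨p, y⟩
  constructor
  · rintro ⟨⟨p', y'⟩, hT, h⟩
    simp only [Prod.mk.injEq] at h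
    obtain ⟨rfl, rfl⟩ := h
    have e : (WithLp.toLp 2 fun i => (c p' i)⁻¹ * (WithLp.toLp 2 fun i => c p' i * y' i : EuclideanSpace ℝ ι) i : EuclideanSpace ℝ ι) = y' :=
      PiLp.ext fun i => by show (c p' i)⁻¹ * (c p' i * y' i) = y' i; rw [inv_mul_cancel_left₀ (hc0 p' i)]
    show (p', (WithLp.toLp 2 fun i => (c p' i)⁻¹ * (WithLp.toLp 2 fun i => c p' i * y' i : EuclideanSpace ℝ ι) i : EuclideanSpace ℝ ι)) ∈ T
    rw [e]; exact hT
  · intro h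
    refine ⟨(p, (WithLp.toLp 2 fun i => (c p i)⁻¹ * y i : EuclideanSpace ℝ ι)), h, ?_⟩
    simp only [Prod.mk.injEq, true_and]
    exact PiLp.ext fun i => by show c p i * ((c p i)⁻¹ * y i) = y i; rw [mul_inv_cancel_left₀ (hc0 p i)]

omit [Fintype ι] [DecidableEq ι] in
/-- ★ Images of measurable sets under the rescaling map are measurable (measurable weights). [folklore] -/
theorem measurableSet_image_diagScale {c : M → ι → ℝ} (hc : ∀ i, Measurable fun p => c p i) (hc0 : ∀ p i, c p i ≠ 0)
    {T : Set (M × EuclideanSpace ℝ ι)} (hT : MeasurableSet T) :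
    MeasurableSet ((fun q : M × EuclideanSpace ℝ ι => (q.1, (WithLp.toLp 2 fun i => c q.1 i * q.2 i : EuclideanSpace ℝ ι))) '' T) := by
  rw [image_diagScale_eq_preimage hc0]
  exact (measurable_diagScale (c := fun p i => (c p i)⁻¹) fun i => (hc i).inv) hT

end Fibrewise

end Summit.QuantumFields.YangMills.Theorems.QuantitativeLaplace

end
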